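import Mathlib
import Literature.Combinatorics.SimpleGraph.HamiltonianCycleListings
import Summits.PneNP.PneNP.Theorems.SymmetryBudgetHamCompilesStubKotzigAux4
import Summits.PneNP.PneNP.Theorems.SymmetryBudgetHamCompilesStubKotzigAux5

/-!
# Stub `stub_kotzig` of line `kotzig-cutspan` (crux `SymmetryBudget.HamCompiles`, stmt-PneNP-10637)

Route `PneNP/SymmetryBudget`, crux `Summit.PneNP.PneNP.Theses.SymmetryBudget.HamCompiles`, line
`kotzig-cutspan` (skeleton `Summits/PneNP/PneNP/Cruxes/HamCompiles/Lines/kotzig-cutspan.lean`),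
registered stub `stub_kotzig`:

  `G.IsHamiltonian ↔ KotzigPred G F` for a finite graph on `≥ 3` vertices and `∅ ≠ F ≠ V`.

* Forward (`kotzigPred_of_listing`, this file): a Hamiltonian cycle, read as a cyclic listing
  (`isHamiltonian_iff_of_three_le_card`) and rotated to start with a vertex of `F` preceded by a
  vertex of `Fᶜ`, is cut (`List.splitBy` on membership in `F`) into its maximal runs
  `P₁ Q₁ P₂ Q₂ ⋯ P_t Q_t` (`P_k ⊆ F`, `Q_k ⊆ Fᶜ`); `PF = [P_k]`, `PA = [(Q_k, (key last P_k,
  key first P_{k+1}))]` (keys `nbA G F`, indices cyclic, read off `ps.zip (ps.rotate 1)` for the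
  list `ps` of pairs `(P_k, Q_k)`) satisfy `KotzigPred`: covers by construction, labels because
  consecutive vertices of the cycle are adjacent, balance because `ps.rotate 1` is a permutation
  of `ps`, connectivity because the labels along the cycle form a closed walk of the junction
  graph.
* Backward (`isHamiltonian_of_kotzigPred`, auxiliary files 1–5): Kotzig's theorem on alternating
  closed trails of balanced connected two-coloured multigraphs (transition systems, merging orbits
  by transpositions) and re-assembly of the trail into a Hamiltonian cycle through junction
  edges, which exist because membership `a ∈ nbA G F u` depends only on the class key of `u`.
-/

-- `Summit.PneNP.PneNP.…` duplicates `PneNP` BY DESIGN (single-problem summit, D-0017).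
set_option linter.dupNamespace false

namespace Summit.PneNP.PneNP.Theorems.HamCompilesKC

open Finset Literature.Combinatorics.SimpleGraph

/-! ### Cutting a Hamiltonian cycle at its junctions -/

section Forward

variable {V : Type*} [Fintype V] [DecidableEq V] (G : SimpleGraph V) [DecidableRel G.Adj]
  (F : Finset V)

omit [Fintype V] [DecidableRel G.Adj] in
/-- A sub-family of the runs of a cyclic listing, covering exactly `S`, is a path cover of
`G[S]`. -/
theorem isCoverOf_of_runs {l : List V} (hl : IsHamCycleListing G.Adj l) {R' M : List (List V)}
    (hR : R'.flatten = l) (hM : M.Sublist R') (hnil : [] ∉ M) (S : Finset V)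
    (hS : ∀ m ∈ M, ∀ v ∈ m, v ∈ S) (hS' : ∀ v ∈ S, ∃ m ∈ M, v ∈ m) (d : V) :
    IsCoverOf G S (M.map fun m => (m.headD d, m.tail)) := by
  have hverts : (M.map fun m => (m.headD d, m.tail)).map VSeq.verts = M := by
    rw [List.map_map]
    conv_rhs => rw [← List.map_id M]
    apply List.map_congr_left
    intro m hm
    exact verts_headD_tail d (fun h => hnil (h ▸ hm))
  obtain ⟨hnd, -, hch, -⟩ := (isHamCycleListing_iff_isChain _ _).1 hl
  refine ⟨?_, ?_, ?_⟩
  · rw [hverts]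
    exact (hR ▸ hnd : R'.flatten.Nodup).sublist hM.flatten
  · rw [hverts]
    ext v
    rw [List.mem_toFinset, List.mem_flatten]
    exact ⟨fun ⟨m, hm, hv⟩ => hS m hm v hv, fun hv => hS' v hv⟩
  · intro p hp
    obtain ⟨m, hm, rfl⟩ := List.mem_map.1 hp
    rw [verts_headD_tail d (fun h => hnil (h ▸ hm))]
    exact hch.infix (hR ▸ List.infix_of_mem_flatten (hM.subset hm))

/-- **Forward direction of `stub_kotzig`**, for a cyclic listing starting in `F` and ending in
`Fᶜ`: cut it into maximal runs and label the A-runs by the keys of the flanking free vertices. -/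
theorem kotzigPred_of_listing {l : List V} (hl : IsHamCycleListing G.Adj l) (hne : l ≠ [])
    (hhead : l.head hne ∈ F) (hlast : l.getLast hne ∉ F) : KotzigPred G F := by
  -- the maximal runs
  set d := l.head hne with hd
  set r : V → V → Bool := fun a b => decide (a ∈ F) == decide (b ∈ F) with hr
  set R := l.splitBy r with hR
  have k1 : R.flatten = l := List.flatten_splitBy r l
  have k2 : [] ∉ R := List.nil_notMem_splitBy r l
  have k3 : ∀ m ∈ R, ∀ x ∈ m, ∀ y ∈ m, (x ∈ F ↔ y ∈ F) := fun m hm =>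
    const_of_isChain F ((List.isChain_of_mem_splitBy hm).imp fun x y h => by simpa [hr] using h)
  have k4 : List.IsChain (fun a b => ∃ ha hb, ¬ (a.getLast ha ∈ F ↔ b.head hb ∈ F)) R :=
    (List.isChain_getLast_head_splitBy r l).imp fun a b ⟨ha, hb, h⟩ =>
      ⟨ha, hb, by simpa [hr] using h⟩
  have hRne : R ≠ [] := List.splitBy_ne_nil.2 hne
  have hRh : R.head hRne ≠ [] := fun h => k2 (h ▸ List.head_mem hRne)
  have hRl : R.getLast hRne ≠ [] := fun h => k2 (h ▸ List.getLast_mem hRne)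
  have hhh : (R.head hRne).head hRh = d := List.head_head_splitBy r hne
  have hll : (R.getLast hRne).getLast hRl = l.getLast hne := List.getLast_getLast_splitBy r hne
  have k5 : ∀ m ∈ R.head?, ∀ x ∈ m.head?, x ∈ F := by
    intro m hm x hx
    rw [List.head?_eq_some_head hRne, Option.mem_def, Option.some.injEq] at hm
    subst hm
    rw [List.head?_eq_some_head hRh, Option.mem_def, Option.some.injEq] at hx
    subst hx
    rw [hhh]
    exact hhead
  have k6 : ∀ m ∈ R.getLast?, ∀ x ∈ m.getLast?, x ∉ F := by
    intro m hm x hx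
    rw [List.getLast?_eq_some_getLast hRne, Option.mem_def, Option.some.injEq] at hm
    subst hm
    rw [List.getLast?_eq_some_getLast hRl, Option.mem_def, Option.some.injEq] at hx
    subst hx
    rw [hll]
    exact hlast
  -- the pairs (F-run, A-run)
  obtain ⟨ps, hint, hmemF⟩ := exists_pairs F R k2 k3 k4 k5 k6
  have hps1 : ∀ ab ∈ ps, ab.1 ≠ [] := fun ab hab h =>
    k2 (hint ▸ List.mem_flatMap.2 ⟨ab, hab, by simp [h]⟩)
  have hps2 : ∀ ab ∈ ps, ab.2 ≠ [] := fun ab hab h =>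
    k2 (hint ▸ List.mem_flatMap.2 ⟨ab, hab, by simp [h]⟩)
  obtain ⟨-, hmem, hch, hwrap⟩ := (isHamCycleListing_iff_isChain _ _).1 hl
  have k7 : List.IsChain (fun a b => ∀ x ∈ a.getLast?, ∀ y ∈ b.head?, G.Adj x y)
      (ps.flatMap fun ab => [ab.1, ab.2]) := by
    rw [hint]
    exact ((List.isChain_flatten k2).1 (k1.symm ▸ hch)).2
  obtain ⟨hin, hbetween⟩ := isChain_flatMap_pair ps k7
  have hpsne : ps ≠ [] := fun h => hRne (by rw [← hint, h, List.flatMap_nil])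
  have hpslen : 0 < ps.length := List.length_pos_iff.2 hpsne
  have hflat : (ps.flatMap fun ab => [ab.1, ab.2]).flatten = l := by rw [hint, k1]
  have hhead_ps : (ps[0].1).headD d = d := by
    have h1 : (ps.flatMap fun ab => [ab.1, ab.2]).head? = some ps[0].1 := by
      rw [head?_flatMap_pair, List.head?_eq_some_head hpsne, List.head_eq_getElem]
      rfl
    rw [hint, List.head?_eq_some_head hRne, Option.some.injEq] at h1
    rw [← h1, List.headD_eq_head?, List.head?_eq_some_head hRh, Option.getD_some]
    exact hhh
  have hlast_ps : (ps[ps.length - 1].2).getLastD d = l.getLast hne := by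
    have h1 : (ps.flatMap fun ab => [ab.1, ab.2]).getLast? = some ps[ps.length - 1].2 := by
      rw [getLast?_flatMap_pair, List.getLast?_eq_some_getLast hpsne, List.getLast_eq_getElem]
      rfl
    rw [hint, List.getLast?_eq_some_getLast hRne, Option.some.injEq] at h1
    rw [← h1, List.getLastD_eq_getLast?, List.getLast?_eq_some_getLast hRl, Option.getD_some]
    exact hll
  -- membership in `l` through the pairs
  have hmem_ps : ∀ v, ∃ ab ∈ ps, v ∈ ab.1 ∨ v ∈ ab.2 := by
    intro v
    obtain ⟨m, hm, hv⟩ := List.mem_flatten.1 (hflat.symm ▸ hmem v)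
    obtain ⟨ab, hab, hm'⟩ := List.mem_flatMap.1 hm
    simp only [List.mem_cons, List.not_mem_nil, or_false] at hm'
    rcases hm' with rfl | rfl
    · exact ⟨ab, hab, Or.inl hv⟩
    · exact ⟨ab, hab, Or.inr hv⟩
  -- junction facts between an F-run and the next A-run, an A-run and the next F-run
  have hjFA : ∀ ab ∈ ps, G.Adj (ab.1.getLastD d) (ab.2.headD d) := by
    intro ab hab
    have := hin ab hab _ (by rw [Option.mem_def, List.getLast?_eq_some_getLast (hps1 ab hab)]) _
      (by rw [Option.mem_def, List.head?_eq_some_head (hps2 ab hab)])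
    rwa [List.getLastD_eq_getLast?, List.getLast?_eq_some_getLast (hps1 ab hab), Option.getD_some,
      List.headD_eq_head?, List.head?_eq_some_head (hps2 ab hab), Option.getD_some]
  have hjAF : ∀ (i : ℕ) (hi : i + 1 < ps.length),
      G.Adj (ps[i].2.getLastD d) (ps[i + 1].1.headD d) := by
    intro i hi
    have h2 := hps2 _ (List.getElem_mem (by omega : i < ps.length))
    have h1 := hps1 _ (List.getElem_mem hi)
    have := List.isChain_iff_getElem.1 hbetween i hi _
      (by rw [Option.mem_def, List.getLast?_eq_some_getLast h2]) _
      (by rw [Option.mem_def, List.head?_eq_some_head h1])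
    rwa [List.getLastD_eq_getLast?, List.getLast?_eq_some_getLast h2, Option.getD_some,
      List.headD_eq_head?, List.head?_eq_some_head h1, Option.getD_some]
  have hjwrap : G.Adj (ps[ps.length - 1].2.getLastD d) (ps[0].1.headD d) := by
    rw [hhead_ps, hlast_ps]
    exact hwrap hne
  -- the data
  set lab := nbA G F with hlab
  set PF : List (VSeq V) := ps.map fun ab => (ab.1.headD d, ab.1.tail) with hPF
  set PA : List (VSeq V × (Finset V × Finset V)) := (ps.zip (ps.rotate 1)).map fun x =>
    ((x.1.2.headD d, x.1.2.tail), (lab (x.1.1.getLastD d), lab (x.2.1.headD d))) with hPA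
  have hlen : (ps.rotate 1).length = ps.length := List.length_rotate _ _
  have hPAfst : PA.map Prod.fst = (ps.map Prod.snd).map fun m => (m.headD d, m.tail) := by
    rw [hPA, List.map_map, List.map_map]
    conv_rhs => rw [← List.map_fst_zip (l₁ := ps) (l₂ := ps.rotate 1) hlen.ge, List.map_map]
    rfl
  refine ⟨PF, PA, ?_, ?_, ?_, ?_, ?_⟩
  · -- cover of `G[F]`
    rw [hPF, show (ps.map fun ab => (ab.1.headD d, ab.1.tail)) =
      (ps.map Prod.fst).map (fun m => (m.headD d, m.tail)) by rw [List.map_map]; rfl]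
    refine isCoverOf_of_runs G hl hflat (map_fst_sublist_flatMap ps) ?_ F ?_ ?_ d
    · intro h
      obtain ⟨ab, hab, e⟩ := List.mem_map.1 h
      exact hps1 ab hab e
    · intro m hm v hv
      obtain ⟨ab, hab, rfl⟩ := List.mem_map.1 hm
      exact (hmemF ab hab).1 v hv
    · intro v hv
      obtain ⟨ab, hab, h | h⟩ := hmem_ps v
      · exact ⟨ab.1, List.mem_map.2 ⟨ab, hab, rfl⟩, h⟩
      · exact absurd hv ((hmemF ab hab).2 v h)
  · -- cover of `G[Fᶜ]`
    rw [hPAfst]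
    refine isCoverOf_of_runs G hl hflat (map_snd_sublist_flatMap ps) ?_ Fᶜ ?_ ?_ d
    · intro h
      obtain ⟨ab, hab, e⟩ := List.mem_map.1 h
      exact hps2 ab hab e
    · intro m hm v hv
      obtain ⟨ab, hab, rfl⟩ := List.mem_map.1 hm
      exact Finset.mem_compl.2 ((hmemF ab hab).2 v hv)
    · intro v hv
      obtain ⟨ab, hab, h | h⟩ := hmem_ps v
      · exact absurd ((hmemF ab hab).1 v h) (Finset.mem_compl.1 hv)
      · exact ⟨ab.2, List.mem_map.2 ⟨ab, hab, rfl⟩, h⟩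
  · -- labels of the A-paths
    intro q hq
    obtain ⟨⟨ab, ab'⟩, hx, rfl⟩ := List.mem_map.1 hq
    obtain ⟨i, hi, habi, hnext⟩ := mem_zip_rotate_one hx
    have hab : ab ∈ ps := habi ▸ List.getElem_mem hi
    have hab2 := hps2 ab hab
    simp only [first_headD_tail, last_headD_tail]
    constructor
    · rw [hlab, nbA, Finset.mem_filter, Finset.mem_compl]
      refine ⟨(hmemF ab hab).2 _ ?_, hjFA ab hab⟩
      rw [List.headD_eq_head?, List.head?_eq_some_head hab2, Option.getD_some]
      exact List.head_mem hab2
    · rw [hlab, nbA, Finset.mem_filter, Finset.mem_compl]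
      refine ⟨(hmemF ab hab).2 _ ?_, ?_⟩
      · rw [List.getLastD_eq_getLast?, List.getLast?_eq_some_getLast hab2, Option.getD_some]
        exact List.getLast_mem hab2
      · rcases hnext with ⟨hi', hab'i⟩ | ⟨hi', hab'i⟩
        · subst habi hab'i
          exact (hjAF i hi').symm
        · subst hab'i
          have e : ab = ps[ps.length - 1] := by
            rw [← habi]
            exact getElem_congr_idx (by omega)
          rw [e]
          exact hjwrap.symm
  · -- balance
    intro i
    unfold fSlots aSlots
    rw [hPF, hPA, List.countP_map, List.countP_map, List.countP_map, List.countP_map]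
    have e1 : ps.countP ((fun p : VSeq V => decide (lab p.first = i)) ∘ fun ab =>
        (ab.1.headD d, ab.1.tail)) = ps.countP fun ab => decide (lab (ab.1.headD d) = i) := rfl
    have e2 : ps.countP ((fun p : VSeq V => decide (lab p.last = i)) ∘ fun ab =>
        (ab.1.headD d, ab.1.tail)) = ps.countP fun ab => decide (lab (ab.1.getLastD d) = i) := by
      apply List.countP_congr
      intro ab _
      simp only [Function.comp_apply, last_headD_tail]
    have e3 : (ps.zip (ps.rotate 1)).countP ((fun q : VSeq V × (Finset V × Finset V) =>
        decide (q.2.1 = i)) ∘ fun x => ((x.1.2.headD d, x.1.2.tail),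
          (lab (x.1.1.getLastD d), lab (x.2.1.headD d)))) =
        ps.countP fun ab => decide (lab (ab.1.getLastD d) = i) := by
      conv_rhs => rw [← List.map_fst_zip (l₁ := ps) (l₂ := ps.rotate 1) hlen.ge,
        List.countP_map]
      rfl
    have e4 : (ps.zip (ps.rotate 1)).countP ((fun q : VSeq V × (Finset V × Finset V) =>
        decide (q.2.2 = i)) ∘ fun x => ((x.1.2.headD d, x.1.2.tail),
          (lab (x.1.1.getLastD d), lab (x.2.1.headD d)))) =
        ps.countP fun ab => decide (lab (ab.1.headD d) = i) := by
      rw [← (List.rotate_perm ps 1).countP_eq]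
      conv_rhs => rw [← List.map_snd_zip (l₁ := ps) (l₂ := ps.rotate 1) hlen.le,
        List.countP_map]
      rfl
    rw [e1, e2, e3, e4, add_comm]
  · -- connectivity of the junction graph on its support
    set J := junctionGraph lab PF PA with hJ
    have rF : ∀ ab ∈ ps, J.Reachable (lab (ab.1.headD d)) (lab (ab.1.getLastD d)) := by
      intro ab hab
      by_cases e : lab (ab.1.headD d) = lab (ab.1.getLastD d)
      · rw [e]
      · apply SimpleGraph.Adj.reachable
        rw [hJ, junctionGraph, SimpleGraph.fromRel_adj]
        refine ⟨e, Or.inl (Or.inl ⟨(ab.1.headD d, ab.1.tail), List.mem_map.2 ⟨ab, hab, rfl⟩,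
          rfl, ?_⟩)⟩
        rw [last_headD_tail]
    have rA : ∀ q ∈ PA, J.Reachable q.2.1 q.2.2 := by
      intro q hq
      by_cases e : q.2.1 = q.2.2
      · rw [e]
      · apply SimpleGraph.Adj.reachable
        rw [hJ, junctionGraph, SimpleGraph.fromRel_adj]
        exact ⟨e, Or.inl (Or.inr ⟨q, hq, rfl, rfl⟩)⟩
    have reach : ∀ (k : ℕ) (hk : k < ps.length), J.Reachable (lab d) (lab (ps[k].1.headD d)) ∧
        J.Reachable (lab d) (lab (ps[k].1.getLastD d)) := by
      intro k
      induction k with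
      | zero =>
        intro hk
        have h1 : J.Reachable (lab d) (lab (ps[0].1.headD d)) := by rw [hhead_ps]
        exact ⟨h1, h1.trans (rF _ (List.getElem_mem hk))⟩
      | succ k ih =>
        intro hk
        have hq : ((ps[k].2.headD d, ps[k].2.tail), (lab (ps[k].1.getLastD d),
            lab (ps[k + 1].1.headD d))) ∈ PA :=
          List.mem_map.2 ⟨(ps[k], ps[k + 1]), getElem_mem_zip_rotate_one hk, rfl⟩
        have h1 : J.Reachable (lab d) (lab (ps[k + 1].1.headD d)) :=
          (ih (by omega)).2.trans (rA _ hq)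
        exact ⟨h1, h1.trans (rF _ (List.getElem_mem hk))⟩
    have hsup : ∀ i, 0 < fSlots lab PF i → J.Reachable (lab d) i := by
      intro i hi
      unfold fSlots at hi
      rcases Nat.add_pos_iff_pos_or_pos.1 hi with hi | hi <;>
        obtain ⟨p, hp, hpi⟩ := List.countP_pos_iff.1 hi <;>
        obtain ⟨ab, hab, rfl⟩ := List.mem_map.1 hp <;>
        obtain ⟨k, hk, rfl⟩ := List.getElem_of_mem hab <;>
        simp only [decide_eq_true_eq, first_headD_tail, last_headD_tail] at hpi <;> subst hpi
      · exact (reach k hk).1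
      · exact (reach k hk).2
    intro i j hi hj
    exact (hsup i hi).symm.trans (hsup j hj)

end Forward

/-! ### The registered stub -/

/-- **`stub_kotzig` (Kotzig's junction lemma).** For a finite graph `G` on `≥ 3` vertices and a
vertex set `F` with `F`, `Fᶜ` nonempty, `G` is Hamiltonian iff it carries the Kotzig interface
data `KotzigPred G F`: a path cover of `G[F]`, a path cover of `G[Fᶜ]` labelled by class keys
containing its path ends, balanced slot counts at every key, and a junction graph connected on its
support.  Forward: cut a Hamiltonian cycle at its `F`–`Fᶜ` junctions.  Backward: Kotzig's
theorem (a connected two-edge-coloured multigraph with colour-balanced degrees has a closed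
Eulerian trail alternating colours — A. Kotzig, Mat. časopis 18 (1968) 76–80; H. Fleischner,
*Eulerian Graphs and Related Topics*, Thm. VI.1), proved here through transition systems, and
re-assembly along junction edges, which exist because `a ∈ nbA G F u` depends only on the class
key `nbA G F u` of the free vertex `u`. -/
theorem stub_kotzig {V : Type*} [Fintype V] [DecidableEq V] (G : SimpleGraph V)
    [DecidableRel G.Adj] (F : Finset V) (h3 : 3 ≤ Fintype.card V) (hF : F.Nonempty)
    (hA : Fᶜ.Nonempty) : G.IsHamiltonian ↔ KotzigPred G F := by
  refine ⟨fun hG => ?_, isHamiltonian_of_kotzigPred G F h3 hA⟩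
  obtain ⟨l, hl⟩ := (isHamiltonian_iff_of_three_le_card G h3).1 hG
  obtain ⟨u₀, hu₀⟩ := hF
  have hne : l ≠ [] := List.ne_nil_of_mem (hl.mem u₀)
  set n := l.length with hn
  have hnpos : 0 < n := List.length_pos_iff.2 hne
  have hrne : ∀ k, l.rotate k ≠ [] := fun k h => hne (List.rotate_eq_nil_iff.1 h)
  set f : ℕ → V := fun k => (l.rotate k).head (hrne k) with hf
  have hf_per : ∀ k, f (k % n) = f k := fun k => by
    have e : l.rotate (k % n) = l.rotate k := List.rotate_mod l k
    simp only [hf]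
    rw [List.head_eq_iff_head?_eq_some, e]
    exact List.head?_eq_some_head _
  have hf_mem : ∀ v ∈ l, ∃ k < n, f k = v := by
    intro v hv
    obtain ⟨k, hk, rfl⟩ := List.getElem_of_mem hv
    refine ⟨k, hk, ?_⟩
    simp only [hf]
    rw [List.head_eq_iff_head?_eq_some, List.head?_rotate hk]
    exact List.getElem?_eq_getElem hk
  have hf_last : ∀ k (h : l.rotate (k + 1) ≠ []), (l.rotate (k + 1)).getLast h = f k := by
    intro k h
    rw [List.getLast_eq_iff_getLast?_eq_some, ← List.rotate_rotate]
    obtain ⟨a, t, hm⟩ := List.exists_cons_of_ne_nil (hrne k)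
    have hfk : f k = a := by
      simp only [hf]
      rw [List.head_eq_iff_head?_eq_some, hm]
      rfl
    rw [hm, List.rotate_cons_succ, List.rotate_zero, hfk, List.getLast?_append,
      List.getLast?_singleton, Option.some_or]
  -- a position where the cycle passes from `Fᶜ` into `F`
  have hk : ∃ k, f k ∉ F ∧ f (k + 1) ∈ F := by
    by_contra hcon
    push Not at hcon
    obtain ⟨a, ha⟩ := hA
    rw [Finset.mem_compl] at ha
    obtain ⟨k₁, -, hk₁⟩ := hf_mem a (hl.mem a)
    have hall : ∀ j, f (k₁ + j) ∉ F := by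
      intro j
      induction j with
      | zero => rw [add_zero, hk₁]; exact ha
      | succ j ih => rw [← add_assoc]; exact hcon _ ih
    obtain ⟨k₂, hk₂, hk₂'⟩ := hf_mem u₀ (hl.mem u₀)
    have key := hall (n - k₁ % n + k₂)
    rw [← hf_per, show (k₁ + (n - k₁ % n + k₂)) % n = k₂ from ?_, hk₂'] at key
    · exact key hu₀
    · have h1 : k₁ % n < n := Nat.mod_lt _ hnpos
      have h2 : n * (k₁ / n) + k₁ % n = k₁ := Nat.div_add_mod k₁ n
      calc (k₁ + (n - k₁ % n + k₂)) % n = (k₂ + n * (k₁ / n + 1)) % n := by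
            congr 1
            rw [mul_add]
            omega
        _ = k₂ := by rw [Nat.add_mul_mod_self_left, Nat.mod_eq_of_lt hk₂]
  obtain ⟨k, hk1, hk2⟩ := hk
  refine kotzigPred_of_listing G F (IsHamCycleListing.rotate hl (k + 1)) (hrne (k + 1)) hk2 ?_
  rw [hf_last k]
  exact hk1

end Summit.PneNP.PneNP.Theorems.HamCompilesKC
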